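import Mathlib.Analysis.SpecialFunctions.Trigonometric.Inverse
import Literature.Algebra.EuclideanLattices.FccBccLattices
import HarnessLib

/-!
# Planar kissing rigidity in a basal plane: six unit vectors pairwise `60°` apart contain the antipode of each

HONEST FRAMING. Part of the venture `Summits/Ventures/Crystal3D` (cell `crystal3d-full`), helper
`--supports` the crux `CoaxialWallLaw` (stmt-Ventures-19481, `route-Ventures-StickyWulffConstant`),
REGISTERED line `WallLedgerF` (planner cf-p1 gen 16), open stub `stub_coaxialTwoSlabAdhesion`.
Pure Euclidean geometry; second brick of the LAMINAR rung (`…CoaxialWallLawLaminarLocal`): in a laminar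
filling an in-plane run END `z` (`z − d ∈ X`, `z + d ∉ X`) has at most FIVE contacts in its own layer, because
six in-layer contacts would form a regular hexagon containing `z − d`, hence `z + d` (this file), so the laminar
local law `deg z ≤ deg₂ z + 6` makes every located in-plane run end pay at itself.  RUNG CREDIT ONLY; F-C1 not
moved.

* `three_angles_false` — three reals `α₁, α₂, α₃ ∈ (−1, ½]` cannot pairwise satisfy
  `αᵢ αⱼ + √(1−αᵢ²) √(1−αⱼ²) ≤ ½` (the angles `arccos αᵢ ∈ [π/3, π)` would be pairwise `≥ π/3` apart).
* **`inPlane_six_antipode`** — `n` a unit vector, `S` a finite set of unit vectors orthogonal to `n`, pairwise at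
  inner product `≤ ½`, `#S ≥ 6`, `a ∈ S` ⇒ `−a ∈ S`.  (Coordinates in the plane via `w = n × a`; the Gram
  identities `⟪u,w⟫² = 1 − ⟪u,a⟫²`, `⟪u,w⟫⟪u',w⟫ = ⟪u,u'⟫ − ⟪u,a⟫⟪u',a⟫`; on each side of the line `ℝa` at
  most two members of `S ∖ {a}` by `three_angles_false`.)

WHAT THIS IS NOT: no packing statement; F-C1 not moved.
-/

noncomputable section

namespace Summit.Ventures.Crystal3D.Theorems

open Finset Real
open Literature.Algebra.EuclideanLattices (inner_fin_three)
open scoped InnerProductSpace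

/-! ## The angle count -/

/-- Ordered core of `three_angles_false`. -/
theorem three_angles_false_ordered {α₁ α₂ α₃ : ℝ} (h₁ : α₁ ≤ 1 / 2) (h₃ : -1 < α₃)
    (h12 : α₂ < α₁) (h23 : α₃ < α₂)
    (p12 : α₁ * α₂ + Real.sqrt (1 - α₁ ^ 2) * Real.sqrt (1 - α₂ ^ 2) ≤ 1 / 2)
    (p23 : α₂ * α₃ + Real.sqrt (1 - α₂ ^ 2) * Real.sqrt (1 - α₃ ^ 2) ≤ 1 / 2) : False := by
  have hα₂u : α₂ ≤ 1 := by linarith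
  have hα₃u : α₃ ≤ 1 := by linarith
  have hα₁l : -1 ≤ α₁ := by linarith
  have hα₂l : -1 ≤ α₂ := by linarith
  set θ₁ := Real.arccos α₁ with hθ₁
  set θ₂ := Real.arccos α₂ with hθ₂
  set θ₃ := Real.arccos α₃ with hθ₃
  have c₁ : Real.cos θ₁ = α₁ := Real.cos_arccos hα₁l (by linarith)
  have c₂ : Real.cos θ₂ = α₂ := Real.cos_arccos hα₂l hα₂u
  have c₃ : Real.cos θ₃ = α₃ := Real.cos_arccos h₃.le hα₃u
  have s₁ : Real.sin θ₁ = Real.sqrt (1 - α₁ ^ 2) := Real.sin_arccos α₁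
  have s₂ : Real.sin θ₂ = Real.sqrt (1 - α₂ ^ 2) := Real.sin_arccos α₂
  have s₃ : Real.sin θ₃ = Real.sqrt (1 - α₃ ^ 2) := Real.sin_arccos α₃
  have hθ₁0 : 0 ≤ θ₁ := Real.arccos_nonneg _
  have hθ₃π : θ₃ < π := by
    have hle := Real.arccos_le_pi α₃
    rcases hle.lt_or_eq with h | h
    · exact h
    · exact absurd (Real.arccos_eq_pi.1 h) (by linarith)
  have h12' : θ₁ < θ₂ := Real.arccos_lt_arccos hα₂l h12 (by linarith)
  have h23' : θ₂ < θ₃ := Real.arccos_lt_arccos h₃.le h23 hα₂u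
  -- each angle is at least `π/3`
  have hπ3 : 0 ≤ π / 3 := by positivity
  have hθ₁ge : π / 3 ≤ θ₁ := by
    by_contra hlt
    push Not at hlt
    have hmem₁ : θ₁ ∈ Set.Icc 0 π := ⟨hθ₁0, Real.arccos_le_pi _⟩
    have hmem₂ : π / 3 ∈ Set.Icc 0 π := ⟨hπ3, by linarith [Real.pi_pos]⟩
    have := Real.strictAntiOn_cos hmem₁ hmem₂ hlt
    rw [Real.cos_pi_div_three, c₁] at this
    linarith
  -- consecutive gaps are at least `π/3`
  have gap : ∀ {x y : ℝ}, 0 ≤ x → x < y → y < π →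
      Real.cos x * Real.cos y + Real.sin x * Real.sin y ≤ 1 / 2 → π / 3 ≤ y - x := by
    intro x y hx hxy hy hle
    by_contra hlt
    push Not at hlt
    have hmem₁ : y - x ∈ Set.Icc 0 π := ⟨by linarith, by linarith⟩
    have hmem₂ : π / 3 ∈ Set.Icc 0 π := ⟨hπ3, by linarith [Real.pi_pos]⟩
    have := Real.strictAntiOn_cos hmem₁ hmem₂ hlt
    rw [Real.cos_pi_div_three, Real.cos_sub] at this
    have e : Real.cos y * Real.cos x + Real.sin y * Real.sin x =
        Real.cos x * Real.cos y + Real.sin x * Real.sin y := by ring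
    linarith
  have g12 := gap hθ₁0 h12' (by linarith) (by rw [c₁, c₂, s₁, s₂]; exact p12)
  have g23 := gap (by linarith) h23' hθ₃π (by rw [c₂, c₃, s₂, s₃]; exact p23)
  linarith

/-- **Three directions on one side cannot be pairwise `60°` apart and `60°` from the axis.**  See the module
docstring. -/
theorem three_angles_false {α₁ α₂ α₃ : ℝ}
    (l₁ : -1 < α₁) (l₂ : -1 < α₂) (l₃ : -1 < α₃) (h₁ : α₁ ≤ 1 / 2) (h₂ : α₂ ≤ 1 / 2) (h₃ : α₃ ≤ 1 / 2)
    (p12 : α₁ * α₂ + Real.sqrt (1 - α₁ ^ 2) * Real.sqrt (1 - α₂ ^ 2) ≤ 1 / 2)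
    (p13 : α₁ * α₃ + Real.sqrt (1 - α₁ ^ 2) * Real.sqrt (1 - α₃ ^ 2) ≤ 1 / 2)
    (p23 : α₂ * α₃ + Real.sqrt (1 - α₂ ^ 2) * Real.sqrt (1 - α₃ ^ 2) ≤ 1 / 2) : False := by
  -- equal parameters are excluded by the pair condition
  have hne : ∀ {x y : ℝ}, -1 < x → x ≤ 1 / 2 →
      x * y + Real.sqrt (1 - x ^ 2) * Real.sqrt (1 - y ^ 2) ≤ 1 / 2 → x ≠ y := by
    intro x y hx hx' hp hxy
    subst hxy
    have h0 : 0 ≤ 1 - x ^ 2 := by nlinarith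
    rw [← Real.sqrt_mul h0, Real.sqrt_mul_self h0] at hp
    linarith
  have n12 := hne l₁ h₁ p12
  have n13 := hne l₁ h₁ p13
  have n23 := hne l₂ h₂ p23
  have sy : ∀ {x y : ℝ}, x * y + Real.sqrt (1 - x ^ 2) * Real.sqrt (1 - y ^ 2) =
      y * x + Real.sqrt (1 - y ^ 2) * Real.sqrt (1 - x ^ 2) := by intro x y; ring
  rcases lt_or_gt_of_ne n12 with a12 | a12 <;> rcases lt_or_gt_of_ne n23 with a23 | a23 <;>
    rcases lt_or_gt_of_ne n13 with a13 | a13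
  -- α₁ < α₂, α₂ < α₃ : order 3 > 2 > 1
  · exact three_angles_false_ordered h₃ l₁ a23 a12 (by rw [sy]; exact p23) (by rw [sy]; exact p12)
  · exact absurd (a12.trans a23) (lt_asymm a13)
  -- α₁ < α₂, α₃ < α₂, α₁ < α₃ : order 2 > 3 > 1
  · exact three_angles_false_ordered h₂ l₁ a23 a13 p23 (by rw [sy]; exact p13)
  -- α₁ < α₂, α₃ < α₂, α₃ < α₁ : order 2 > 1 > 3
  · exact three_angles_false_ordered h₂ l₃ a12 a13 (by rw [sy]; exact p12) p13
  -- α₂ < α₁, α₂ < α₃, α₁ < α₃ : order 3 > 1 > 2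
  · exact three_angles_false_ordered h₃ l₂ a13 a12 (by rw [sy]; exact p13) p12
  -- α₂ < α₁, α₂ < α₃, α₃ < α₁ : order 1 > 3 > 2
  · exact three_angles_false_ordered h₁ l₂ a13 a23 p13 (by rw [sy]; exact p23)
  -- α₂ < α₁, α₃ < α₂ : order 1 > 2 > 3
  · exact absurd (a23.trans a12) (lt_asymm a13)
  · exact three_angles_false_ordered h₁ l₃ a12 a23 p12 p23

/-! ## Plane coordinates via the cross product -/

/-- Gram identity in coordinates: for `n, a` orthonormal and `u` a unit vector orthogonal to `n`,
`(u · (n × a))² = 1 − (u · a)²`. -/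
theorem gram_sq_coord (u0 u1 u2 n0 n1 n2 a0 a1 a2 : ℝ)
    (hn : n0 * n0 + n1 * n1 + n2 * n2 = 1) (ha : a0 * a0 + a1 * a1 + a2 * a2 = 1)
    (han : a0 * n0 + a1 * n1 + a2 * n2 = 0) (hu : u0 * u0 + u1 * u1 + u2 * u2 = 1)
    (hun : u0 * n0 + u1 * n1 + u2 * n2 = 0) :
    (u0 * (n1 * a2 - n2 * a1) + u1 * (n2 * a0 - n0 * a2) + u2 * (n0 * a1 - n1 * a0)) ^ 2 =
      1 - (u0 * a0 + u1 * a1 + u2 * a2) ^ 2 := by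
  linear_combination ((n0 * n0 + n1 * n1 + n2 * n2) * (a0 * a0 + a1 * a1 + a2 * a2) -
      (a0 * n0 + a1 * n1 + a2 * n2) ^ 2) * hu +
    ((a0 * a0 + a1 * a1 + a2 * a2) - (u0 * a0 + u1 * a1 + u2 * a2) ^ 2) * hn + ha -
    (a0 * n0 + a1 * n1 + a2 * n2) * han +
    (2 * (a0 * n0 + a1 * n1 + a2 * n2) * (u0 * a0 + u1 * a1 + u2 * a2) -
      (u0 * n0 + u1 * n1 + u2 * n2) * (a0 * a0 + a1 * a1 + a2 * a2)) * hun

/-- Polarised Gram identity in coordinates: `(u · (n × a)) (u' · (n × a)) = u · u' − (u · a)(u' · a)` for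
`n, a` orthonormal and `u` orthogonal to `n` (sic: `u'` need not be). -/
theorem gram_mul_coord (u0 u1 u2 v0 v1 v2 n0 n1 n2 a0 a1 a2 : ℝ)
    (hn : n0 * n0 + n1 * n1 + n2 * n2 = 1) (ha : a0 * a0 + a1 * a1 + a2 * a2 = 1)
    (han : a0 * n0 + a1 * n1 + a2 * n2 = 0)
    (hun : u0 * n0 + u1 * n1 + u2 * n2 = 0) :
    (u0 * (n1 * a2 - n2 * a1) + u1 * (n2 * a0 - n0 * a2) + u2 * (n0 * a1 - n1 * a0)) *
        (v0 * (n1 * a2 - n2 * a1) + v1 * (n2 * a0 - n0 * a2) + v2 * (n0 * a1 - n1 * a0)) =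
      (u0 * v0 + u1 * v1 + u2 * v2) - (u0 * a0 + u1 * a1 + u2 * a2) * (v0 * a0 + v1 * a1 + v2 * a2) := by
  linear_combination ((u0 * v0 + u1 * v1 + u2 * v2) * (a0 * a0 + a1 * a1 + a2 * a2) -
      (u0 * a0 + u1 * a1 + u2 * a2) * (v0 * a0 + v1 * a1 + v2 * a2)) * hn +
    (u0 * v0 + u1 * v1 + u2 * v2) * ha +
    ((u0 * a0 + u1 * a1 + u2 * a2) * (v0 * n0 + v1 * n1 + v2 * n2) -
      (u0 * v0 + u1 * v1 + u2 * v2) * (a0 * n0 + a1 * n1 + a2 * n2)) * han +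
    ((a0 * n0 + a1 * n1 + a2 * n2) * (v0 * a0 + v1 * a1 + v2 * a2) -
      (v0 * n0 + v1 * n1 + v2 * n2) * (a0 * a0 + a1 * a1 + a2 * a2)) * hun

/-- **Six coplanar unit vectors pairwise at inner product `≤ ½` contain the antipode of each of them.**  See the
module docstring. -/
theorem inPlane_six_antipode {n a : EuclideanSpace ℝ (Fin 3)} (hn : ‖n‖ = 1)
    (S : Finset (EuclideanSpace ℝ (Fin 3))) (hS1 : ∀ u ∈ S, ‖u‖ = 1) (hun : ∀ u ∈ S, ⟪u, n⟫_ℝ = 0)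
    (hsep : ∀ u ∈ S, ∀ u' ∈ S, u ≠ u' → ⟪u, u'⟫_ℝ ≤ 1 / 2) (h6 : 6 ≤ S.card) (ha : a ∈ S) :
    -a ∈ S := by
  classical
  by_contra hna
  have ha1 : ‖a‖ = 1 := hS1 a ha
  have han : ⟪a, n⟫_ℝ = 0 := hun a ha
  -- the in-plane normal `w = n × a`
  set w : EuclideanSpace ℝ (Fin 3) := !₂[n 1 * a 2 - n 2 * a 1, n 2 * a 0 - n 0 * a 2, n 0 * a 1 - n 1 * a 0]
    with hw
  have hw0 : w 0 = n 1 * a 2 - n 2 * a 1 := by simp [hw]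
  have hw1 : w 1 = n 2 * a 0 - n 0 * a 2 := by simp [hw]
  have hw2 : w 2 = n 0 * a 1 - n 1 * a 0 := by simp [hw]
  have hsq : ∀ v : EuclideanSpace ℝ (Fin 3), ‖v‖ ^ 2 = v 0 * v 0 + v 1 * v 1 + v 2 * v 2 := by
    intro v; rw [← real_inner_self_eq_norm_sq, inner_fin_three]
  have hn' : n 0 * n 0 + n 1 * n 1 + n 2 * n 2 = 1 := by rw [← hsq, hn, one_pow]
  have ha' : a 0 * a 0 + a 1 * a 1 + a 2 * a 2 = 1 := by rw [← hsq, ha1, one_pow]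
  have han' : a 0 * n 0 + a 1 * n 1 + a 2 * n 2 = 0 := by rw [← inner_fin_three]; exact han
  -- Gram identities for members of `S`
  have gram1 : ∀ u ∈ S, ⟪u, w⟫_ℝ ^ 2 = 1 - ⟪u, a⟫_ℝ ^ 2 := by
    intro u huS
    have hu' : u 0 * u 0 + u 1 * u 1 + u 2 * u 2 = 1 := by rw [← hsq, hS1 u huS, one_pow]
    have hun' : u 0 * n 0 + u 1 * n 1 + u 2 * n 2 = 0 := by rw [← inner_fin_three]; exact hun u huS
    rw [inner_fin_three, inner_fin_three, hw0, hw1, hw2]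
    exact gram_sq_coord _ _ _ _ _ _ _ _ _ hn' ha' han' hu' hun'
  have gram2 : ∀ u ∈ S, ∀ u' ∈ S, ⟪u, w⟫_ℝ * ⟪u', w⟫_ℝ = ⟪u, u'⟫_ℝ - ⟪u, a⟫_ℝ * ⟪u', a⟫_ℝ := by
    intro u huS u' _
    have hun' : u 0 * n 0 + u 1 * n 1 + u 2 * n 2 = 0 := by rw [← inner_fin_three]; exact hun u huS
    rw [inner_fin_three, inner_fin_three, inner_fin_three, inner_fin_three, inner_fin_three, hw0, hw1, hw2]
    exact gram_mul_coord _ _ _ _ _ _ _ _ _ _ _ _ hn' ha' han' hun'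
  -- members other than `a`: `α ≤ ½`, `−1 < α`, `β ≠ 0`
  set T := S.erase a with hT
  have hTS : ∀ u ∈ T, u ∈ S := fun u hu => mem_of_mem_erase hu
  have hα : ∀ u ∈ T, ⟪u, a⟫_ℝ ≤ 1 / 2 := fun u hu =>
    hsep u (hTS u hu) a ha (ne_of_mem_erase hu)
  have hαl : ∀ u ∈ T, -1 < ⟪u, a⟫_ℝ := by
    intro u hu
    have h1 : -1 ≤ ⟪u, a⟫_ℝ := by
      have := abs_real_inner_le_norm u a
      rw [hS1 u (hTS u hu), ha1, one_mul] at this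
      linarith [neg_abs_le ⟪u, a⟫_ℝ]
    rcases h1.lt_or_eq with h | h
    · exact h
    · -- `⟪u, a⟫ = −1` forces `u = −a`
      exfalso
      have hzero : ‖u + a‖ ^ 2 = 0 := by
        rw [norm_add_sq_real, hS1 u (hTS u hu), ha1, ← h]; ring
      have : u + a = 0 := by
        have := pow_eq_zero_iff (n := 2) (by norm_num) |>.1 hzero
        exact norm_eq_zero.1 this
      exact hna (by rw [show -a = u from (eq_neg_of_add_eq_zero_left this).symm]; exact hTS u hu)
  -- same-side pairs realise the planar cosine
  have hpair : ∀ u ∈ T, ∀ u' ∈ T, u ≠ u' → 0 < ⟪u, w⟫_ℝ * ⟪u', w⟫_ℝ →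
      ⟪u, a⟫_ℝ * ⟪u', a⟫_ℝ + Real.sqrt (1 - ⟪u, a⟫_ℝ ^ 2) * Real.sqrt (1 - ⟪u', a⟫_ℝ ^ 2) ≤ 1 / 2 := by
    intro u hu u' hu' hne hpos
    have h1 := gram1 u (hTS u hu)
    have h2 := gram1 u' (hTS u' hu')
    have h12 := gram2 u (hTS u hu) u' (hTS u' hu')
    have hs : Real.sqrt (1 - ⟪u, a⟫_ℝ ^ 2) * Real.sqrt (1 - ⟪u', a⟫_ℝ ^ 2) = ⟪u, w⟫_ℝ * ⟪u', w⟫_ℝ := by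
      rw [← h1, ← h2, Real.sqrt_sq_eq_abs, Real.sqrt_sq_eq_abs, ← abs_mul, abs_of_pos hpos]
    rw [hs, h12]
    have := hsep u (hTS u hu) u' (hTS u' hu') hne
    linarith
  -- split `T` by the side of the line `ℝ a`
  set Tp := T.filter fun u => 0 < ⟪u, w⟫_ℝ with hTp
  set Tm := T.filter fun u => ⟪u, w⟫_ℝ < 0 with hTm
  have hβ0 : ∀ u ∈ T, ⟪u, w⟫_ℝ ≠ 0 := by
    intro u hu h0
    have h1 := gram1 u (hTS u hu)
    rw [h0] at h1
    have : ⟪u, a⟫_ℝ ^ 2 = 1 := by linarith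
    have hαu := hα u hu
    have hαl' := hαl u hu
    nlinarith
  have hTsplit : T.card ≤ Tp.card + Tm.card := by
    have : T ⊆ Tp ∪ Tm := by
      intro u hu
      rcases lt_trichotomy 0 ⟪u, w⟫_ℝ with h | h | h
      · exact mem_union_left _ (mem_filter.2 ⟨hu, h⟩)
      · exact absurd h.symm (hβ0 u hu)
      · exact mem_union_right _ (mem_filter.2 ⟨hu, h⟩)
    exact (card_le_card this).trans (card_union_le _ _)
  have hTcard : 5 ≤ T.card := by
    rw [hT, card_erase_of_mem ha]; omega
  -- three members on one side give the contradiction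
  have three : ∀ (U : Finset (EuclideanSpace ℝ (Fin 3))), U ⊆ T →
      (∀ u ∈ U, ∀ u' ∈ U, 0 < ⟪u, w⟫_ℝ * ⟪u', w⟫_ℝ) → 3 ≤ U.card → False := by
    intro U hUT hside h3
    obtain ⟨V, hVU, hV3⟩ := Finset.exists_subset_card_eq h3
    obtain ⟨u₁, u₂, u₃, h12, h13, h23, hVeq⟩ := Finset.card_eq_three.1 hV3
    have m₁ : u₁ ∈ U := hVU (by rw [hVeq]; simp)
    have m₂ : u₂ ∈ U := hVU (by rw [hVeq]; simp)
    have m₃ : u₃ ∈ U := hVU (by rw [hVeq]; simp)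
    exact three_angles_false (hαl u₁ (hUT m₁)) (hαl u₂ (hUT m₂)) (hαl u₃ (hUT m₃))
      (hα u₁ (hUT m₁)) (hα u₂ (hUT m₂)) (hα u₃ (hUT m₃))
      (hpair u₁ (hUT m₁) u₂ (hUT m₂) h12 (hside u₁ m₁ u₂ m₂))
      (hpair u₁ (hUT m₁) u₃ (hUT m₃) h13 (hside u₁ m₁ u₃ m₃))
      (hpair u₂ (hUT m₂) u₃ (hUT m₃) h23 (hside u₂ m₂ u₃ m₃))
  by_cases hp3 : 3 ≤ Tp.card
  · exact three Tp (filter_subset _ _)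
      (fun u hu u' hu' => mul_pos (mem_filter.1 hu).2 (mem_filter.1 hu').2) hp3
  · have hm3 : 3 ≤ Tm.card := by omega
    exact three Tm (filter_subset _ _)
      (fun u hu u' hu' => mul_pos_of_neg_of_neg (mem_filter.1 hu).2 (mem_filter.1 hu').2) hm3

end Summit.Ventures.Crystal3D.Theorems

end
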